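import Literature.Probability.Percolation.SharpnessDCTProofs
import HarnessLib

/-!
# Bond classes of the box `Λ_n ⊂ ℤ²×ℤ` (line `locmod`, crux `CriticalCurveRegular`, stmt-CriticalPhenomena-16065)

Bookkeeping shared by the local-modification stub and the closing file: the vertical bonds
`KV n = {{x, x+e₃} : x, x+e₃ ∈ Λ_n}` and horizontal bonds `KH n` of `Λ_n = box 3 n` are pairs of
`Λ_n`, disjoint, and together they are exactly the lattice bonds with both endpoints in `Λ_n`.
All statements are over the literal `Finset.image`/`Finset.filter` terms of the registered stubs.
-/

noncomputable section

open Set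
open Literature.Probability.Percolation Literature.Probability.LatticeModels

namespace Summit.CriticalPhenomena.PercolationContinuityZ3.Cruxes.CriticalCurveRegular.Locmod

namespace BoxBonds

/-- A vertical bond is not a horizontal bond (compare third coordinates). -/
theorem mk_vert_ne_mk_horiz (x y : Site 3) {i : Fin 3} (hi : i ≠ 2) :
    s(x, x + Pi.single (2 : Fin 3) 1) ≠ s(y, y + Pi.single i 1) := by
  have hi0 : (Pi.single i (1 : ℤ) : Site 3) 2 = 0 := by
    rw [Pi.single_apply, if_neg (Ne.symm hi)]
  intro h
  rw [Sym2.eq_iff] at h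
  rcases h with ⟨h1, h2⟩ | ⟨h1, h2⟩
  · have a := congrFun h2 2
    have b := congrFun h1 2
    simp only [Pi.add_apply, hi0, Pi.single_eq_same] at a
    omega
  · have a := congrFun h2 2
    have b := congrFun h1 2
    simp only [Pi.add_apply, hi0, Pi.single_eq_same] at a b
    omega

/-- The vertical bonds of `Λ_n` are pairs of `Λ_n`. -/
theorem KV_subset_sym2 (n : ℕ) :
    (((box 3 n).filter fun x => x + Pi.single (2 : Fin 3) 1 ∈ box 3 n).image
        fun x => s(x, x + Pi.single (2 : Fin 3) 1)) ⊆ (box 3 n).sym2 := by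
  intro e he
  simp only [Finset.mem_image, Finset.mem_filter] at he
  obtain ⟨x, ⟨hx, hx'⟩, rfl⟩ := he
  exact Finset.mk_mem_sym2_iff.2 ⟨hx, hx'⟩

/-- The horizontal bonds of `Λ_n` in direction `i` are pairs of `Λ_n`. -/
theorem KHd_subset_sym2 (i : Fin 3) (n : ℕ) :
    (((box 3 n).filter fun x => x + Pi.single i 1 ∈ box 3 n).image fun x => s(x, x + Pi.single i 1)) ⊆
      (box 3 n).sym2 := by
  intro e he
  simp only [Finset.mem_image, Finset.mem_filter] at he
  obtain ⟨x, ⟨hx, hx'⟩, rfl⟩ := he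
  exact Finset.mk_mem_sym2_iff.2 ⟨hx, hx'⟩

/-- The horizontal bonds of `Λ_n` are pairs of `Λ_n`. -/
theorem KH_subset_sym2 (n : ℕ) :
    ((((box 3 n).filter fun x => x + Pi.single (0 : Fin 3) 1 ∈ box 3 n).image
          fun x => s(x, x + Pi.single (0 : Fin 3) 1)) ∪
        (((box 3 n).filter fun x => x + Pi.single (1 : Fin 3) 1 ∈ box 3 n).image
          fun x => s(x, x + Pi.single (1 : Fin 3) 1))) ⊆ (box 3 n).sym2 :=
  Finset.union_subset (KHd_subset_sym2 0 n) (KHd_subset_sym2 1 n)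

/-- A vertical bond is no horizontal bond. -/
theorem disjoint_KV_KH (n : ℕ) :
    Disjoint
      (((box 3 n).filter fun x => x + Pi.single (2 : Fin 3) 1 ∈ box 3 n).image
        fun x => s(x, x + Pi.single (2 : Fin 3) 1))
      ((((box 3 n).filter fun x => x + Pi.single (0 : Fin 3) 1 ∈ box 3 n).image
          fun x => s(x, x + Pi.single (0 : Fin 3) 1)) ∪
        (((box 3 n).filter fun x => x + Pi.single (1 : Fin 3) 1 ∈ box 3 n).image
          fun x => s(x, x + Pi.single (1 : Fin 3) 1))) := by
  rw [Finset.disjoint_left]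
  intro e heV heH
  simp only [Finset.mem_image, Finset.mem_filter] at heV
  obtain ⟨x, -, rfl⟩ := heV
  simp only [Finset.mem_union, Finset.mem_image, Finset.mem_filter] at heH
  rcases heH with ⟨y, -, hy⟩ | ⟨y, -, hy⟩
  · exact mk_vert_ne_mk_horiz x y (by decide) hy.symm
  · exact mk_vert_ne_mk_horiz x y (by decide) hy.symm

/-- A lattice bond with both endpoints in `Λ_n` is a vertical or a horizontal bond of `Λ_n`. -/
theorem mem_KV_or_KH_of_edge {n : ℕ} {g : Sym2 (Site 3)} (hg : g ∈ (zdGraph 3).edgeSet)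
    (hgΛ : ∀ y ∈ g, y ∈ box 3 n) :
    g ∈ (((box 3 n).filter fun x => x + Pi.single (2 : Fin 3) 1 ∈ box 3 n).image
        fun x => s(x, x + Pi.single (2 : Fin 3) 1)) ∪
      ((((box 3 n).filter fun x => x + Pi.single (0 : Fin 3) 1 ∈ box 3 n).image
          fun x => s(x, x + Pi.single (0 : Fin 3) 1)) ∪
        (((box 3 n).filter fun x => x + Pi.single (1 : Fin 3) 1 ∈ box 3 n).image
          fun x => s(x, x + Pi.single (1 : Fin 3) 1))) := by
  -- an edge of `ℤ³` is `{y, y + eᵢ}`; read off the direction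
  obtain ⟨y, i, rfl⟩ : ∃ y : Site 3, ∃ i : Fin 3, g = s(y, y + Pi.single i 1) := by
    induction g using Sym2.ind with
    | h a b =>
      rw [SimpleGraph.mem_edgeSet, zdGraph_adj_iff] at hg
      obtain ⟨i, h | h⟩ := hg
      · exact ⟨a, i, by rw [h]⟩
      · exact ⟨b, i, by rw [h, Sym2.eq_swap]⟩
  have hy : y ∈ box 3 n := hgΛ y (Sym2.mem_mk_left _ _)
  have hyi : y + Pi.single i 1 ∈ box 3 n := hgΛ _ (Sym2.mem_mk_right _ _)
  simp only [Finset.mem_union, Finset.mem_image, Finset.mem_filter]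
  fin_cases i
  · exact Or.inr (Or.inl ⟨y, ⟨hy, hyi⟩, rfl⟩)
  · exact Or.inr (Or.inr ⟨y, ⟨hy, hyi⟩, rfl⟩)
  · exact Or.inl ⟨y, ⟨hy, hyi⟩, rfl⟩

/-- A horizontal lattice bond with both endpoints in `Λ_n` is a horizontal bond of `Λ_n`. -/
theorem mem_KH_of_horiz {n : ℕ} {y : Site 3} {i : Fin 3} (hi : i ≠ 2) (hy : y ∈ box 3 n)
    (hyi : y + Pi.single i 1 ∈ box 3 n) :
    s(y, y + Pi.single i 1) ∈
      ((((box 3 n).filter fun x => x + Pi.single (0 : Fin 3) 1 ∈ box 3 n).image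
          fun x => s(x, x + Pi.single (0 : Fin 3) 1)) ∪
        (((box 3 n).filter fun x => x + Pi.single (1 : Fin 3) 1 ∈ box 3 n).image
          fun x => s(x, x + Pi.single (1 : Fin 3) 1))) := by
  simp only [Finset.mem_union, Finset.mem_image, Finset.mem_filter]
  fin_cases i
  · exact Or.inl ⟨y, ⟨hy, hyi⟩, rfl⟩
  · exact Or.inr ⟨y, ⟨hy, hyi⟩, rfl⟩
  · exact absurd rfl hi

/-- Bonds of `Λ_n` (vertical or horizontal) are lattice bonds with both endpoints in `Λ_n`. -/
theorem edge_of_mem_KV_KH {n : ℕ} {g : Sym2 (Site 3)}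
    (hg : g ∈ (((box 3 n).filter fun x => x + Pi.single (2 : Fin 3) 1 ∈ box 3 n).image
        fun x => s(x, x + Pi.single (2 : Fin 3) 1)) ∪
      ((((box 3 n).filter fun x => x + Pi.single (0 : Fin 3) 1 ∈ box 3 n).image
          fun x => s(x, x + Pi.single (0 : Fin 3) 1)) ∪
        (((box 3 n).filter fun x => x + Pi.single (1 : Fin 3) 1 ∈ box 3 n).image
          fun x => s(x, x + Pi.single (1 : Fin 3) 1)))) :
    g ∈ (zdGraph 3).edgeSet ∧ ∀ y ∈ g, y ∈ box 3 n := by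
  simp only [Finset.mem_union, Finset.mem_image, Finset.mem_filter] at hg
  have key : ∀ (i : Fin 3) (y : Site 3), y ∈ box 3 n → y + Pi.single i 1 ∈ box 3 n →
      s(y, y + Pi.single i 1) ∈ (zdGraph 3).edgeSet ∧ ∀ v ∈ s(y, y + Pi.single i 1), v ∈ box 3 n := by
    intro i y hy hyi
    refine ⟨(SimpleGraph.mem_edgeSet (zdGraph 3)).2 ((zdGraph_adj_iff y _).2 ⟨i, Or.inl rfl⟩), fun v hv => ?_⟩
    rcases Sym2.mem_iff.1 hv with rfl | rfl
    · exact hy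
    · exact hyi
  rcases hg with ⟨y, ⟨hy, hyi⟩, rfl⟩ | ⟨y, ⟨hy, hyi⟩, rfl⟩ | ⟨y, ⟨hy, hyi⟩, rfl⟩
  · exact key 2 y hy hyi
  · exact key 0 y hy hyi
  · exact key 1 y hy hyi

/-! ## Registered export -/

/-- **Disjointness of the bond classes (registered helper signature of this file; = `disjoint_KV_KH`).** -/
theorem locMod_boxbonds_main :
    ∀ n : ℕ, Disjoint
      (((box 3 n).filter fun x => x + Pi.single (2 : Fin 3) 1 ∈ box 3 n).image
        fun x => s(x, x + Pi.single (2 : Fin 3) 1))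
      ((((box 3 n).filter fun x => x + Pi.single (0 : Fin 3) 1 ∈ box 3 n).image
          fun x => s(x, x + Pi.single (0 : Fin 3) 1)) ∪
        (((box 3 n).filter fun x => x + Pi.single (1 : Fin 3) 1 ∈ box 3 n).image
          fun x => s(x, x + Pi.single (1 : Fin 3) 1))) :=
  fun n => disjoint_KV_KH n

end BoxBonds

end Summit.CriticalPhenomena.PercolationContinuityZ3.Cruxes.CriticalCurveRegular.Locmod

end
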